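import Summits.QuantumFields.YangMills.Theses.VirialFluxGap
import HarnessLib

/-!
# Route `VirialFluxGap` (YangMills): the assembly item `Assembly` (stmt-QuantumFields-24144) holds BY NAME

`Assembly := PeriodicSoftness → TwistedEquipartition → SectorWeightSmooth → FluxSectorLaplace.FluxSectorSuppression` —
the monotone transport of the Tomboulis–Yaffe reflection-positivity anchor from `√β` to `β`: with `(a₁, c)` from
`PeriodicSoftness` and `a₂` from `TwistedEquipartition` at `ε = c/2`, the function
`φ(b) = log W_z(b) − log W_0(b) + (c/2)·log b` is antitone on `[√β, β]`, the landed anchor `W_z(√β) ≤ W_0(√β)`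
(`TT.sectorWeight_one_le_untwisted`) starts it, and `W_z(β) ≤ β^(−c/4)·W_0(β) ≤ 8β^(−c/4)·Z_phys(2L) ≤ β^(−a)·Z_phys(2L)`
follows.  The proof is the route's own deciding theorem `VirialFluxGap.closes` (planner ym-idea-4 g14, LINE g14-A,
gate-written with the route file); this file closes the item by name.

HONEST FRAMING: bookkeeping; the cruxes `PeriodicSoftness` (stmt-QuantumFields-24141) and `TwistedEquipartition`
(stmt-QuantumFields-24142, split into 24204/24181/24182/24183) are OPEN, so the leaf `FluxSectorSuppression`
(stmt-QuantumFields-24079) is NOT proved here; the line is DRAFT-by-design (closes → leaf, not `YangMills`); no summit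
conjunct is touched; the Yang–Mills mass gap is NOT proved.  No `sorry`, no new axiom, no new definition.
References: [cite: TomboulisYaffe1985]; [cite: tHooft1979].
-/

set_option autoImplicit false

namespace Summit.QuantumFields.YangMills.Theorems.VirialFluxGap

/-- **`Assembly` holds** (item stmt-QuantumFields-24144 of route `VirialFluxGap`, BY NAME):
`PeriodicSoftness → TwistedEquipartition → SectorWeightSmooth → FluxSectorLaplace.FluxSectorSuppression`,
the route's deciding theorem `closes`.  [cite: TomboulisYaffe1985] [cite: tHooft1979] -/
theorem assembly_proof :
    Summit.QuantumFields.YangMills.Theses.VirialFluxGap.Assembly :=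
  fun hP hT hS => Summit.QuantumFields.YangMills.Theses.VirialFluxGap.closes hP hT hS

end Summit.QuantumFields.YangMills.Theorems.VirialFluxGap
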